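/-
COR-CM (cell pub-hodgecm2, stage 2 of the Hodge ladder), §B INFRA-02-2S (litscope-2 §B-v3.2 R2 (c), b-seat take):
the CM-type Hodge structure `CMTypeHodge.hodge K Φ` IS `H¹(A(ℂ); ℚ)` of every realisation `(A, ι, θ)` of `(K; Φ)`.
Seat prover-pub-hodgecm2-b02 (gen 9), 2026-08-20.
-/
import Summits.HodgeConjecture.CorCM.Model.CMTypeUniverse
import Literature.AlgebraicGeometry.ComplexMultiplication.ShimuraIsogenyBetti
import Literature.AlgebraicGeometry.ComplexMultiplication.CMFieldActionHOne
import Literature.AlgebraicGeometry.HodgeTheory.BettiUniverseCMTypes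
import Literature.AlgebraicGeometry.Motives.GeometricVHSPolarizedTransport
import HarnessLib

/-!
# The Betti model of the CM-type Hodge structure

For a CM type `(K; Φ)` and a realisation `(A, ι, θ)` of it read on `H¹`
(`ComplexMultiplication.IsCMTypeRealisation Φ A ι θ`: `A/ℂ` an abelian variety, `θ = ι^*` on `𝓞_K`,
`dim H¹ = [K:ℚ]`, one-dimensional `σ`-eigenlines of type `(1,0)` for `σ ∈ Φ` and `(0,1)` for `σ ∉ Φ`;
Shimura 1998 §5.2 / §6.2), the ABSTRACT weight-one `ℚ`-Hodge structure of the CM type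
`CMTypeHodge.hodge K Φ` on `V = K` (`H^{1,0} = ⊕_{σ ∈ Φ} (ℂ ⊗ K)_σ`; Deligne, LNM 900, Example 3.7 / §4;
`CorCM/Model/CMTypeUniverse`) is ISOMORPHIC, `K`-equivariantly, to the GEOMETRIC one
`BettiUniverse.hodge hHD hA 1` on `H¹(A(ℂ); ℚ)` with its rational CM action `BettiUniverse.cmAction θ hθ`
(`HodgeTheory/BettiUniverseCMAction`).  In the tree's idiom for isomorphic Hodge structures
(`Motives.HodgeStructure.comapEquiv`, transport along a `ℚ`-linear equivalence):

* `map_eigenLine_eq` — a `K`-equivariant `ℚ`-linear isomorphism `e : K ≃ H¹(A(ℂ); ℚ)` carries, after `⊗ ℂ`,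
  the eigen-line `(ℂ ⊗ K)_σ` ONTO the joint `σ`-eigenspace `H¹_σ` (both are lines);
* `F_one_eq_iSup` — `F¹ H¹(A) = H^{1,0}(A) = ⊕_{σ ∈ Φ} H¹_σ` (the CM-type clauses through
  `BettiUniverse.eigenPiece_one_zero_eq_eigenLine` / `_eq_bot`, and `V^{1,0} = ⊕_σ V^{1,0}_σ`,
  `EndAction.iSup_eigenPiece_holds`);
* `hodge_eq_comapEquiv` — **rigidity**: EVERY `K`-equivariant `ℚ`-linear isomorphism `e : K ≃ H¹(A(ℂ); ℚ)`
  is an isomorphism of Hodge structures, `CMTypeHodge.hodge K Φ = (BettiUniverse.hodge hHD hA 1).comapEquiv e`;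
* `exists_equivariant_equiv` — such an `e` exists (`H¹(A(ℂ); ℚ)` is a `K`-line: `k ↦ k ⋅ v₀` for any `v₀ ≠ 0`,
  `orbit_injective`), whence the packaged `exists_hodge_eq_comapEquiv`;
* `cmType_eq`, `isCM` — read in the tree's ABSTRACT vocabulary for number-field actions on Hodge structures
  (`Motives.HodgeStructure.EndAction.cmType / IsCM`, `Motives/WeilTypeCM`): the rational CM action
  `BettiUniverse.cmEndAction θ hθ hHD hI hA` of a realisation of `(K; Φ)` has multiplicities `n_σ = 1` for `σ ∈ Φ`,
  `0` otherwise (`multiplicity_eq_one_of_mem` / `multiplicity_eq_zero_of_not_mem`), CM TYPE `Φ` (`cmType_eq`), and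
  `H¹(A(ℂ); ℚ)` is a `K`-LINE for it (`finrank_eq_one`), so it `IsCM` for `K` a CM field (`isCM`).

Transport of invariants is then BY NAME (`HodgeStructure.comapEquiv_hodgeClasses`, `comapEquiv_piece`,
`IsPolarizable.comapEquiv`, `mtRank_comapEquiv`, `tensorPower_comapEquiv`, …).  All `theorem`s, no definition,
no named fact; `hHD : exists_isReal_hodgeModel`, `hI : hodgePQ_independent_of_hodgeModel` are the LIGHT
hypotheses of `BettiUniverseCMAction` (both theorems of the tree, `exists_isReal_hodgeModel_holds`,
`hodgePQ_independent_of_hodgeModel_holds`).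

## References

* [Deligne1982HodgeCycles] P. Deligne, Hodge cycles on abelian varieties, LNM 900 (1982), Example 3.7, §4–§5
  (`E ⊗ ℂ = ⊕_σ ℂ_σ`, `H^{1,0} = ⊕_{σ ∈ Φ}`; an `E`-Hodge structure of CM type is determined by `Φ`).
* [Shimura1998] G. Shimura, Abelian Varieties with Complex Multiplication and Modular Functions (1998),
  §3.2 pp. 20–22 (rational vs analytic representation), §5.2 pp. 36–37, §6.2 Thm. 3.
-/

noncomputable section

open scoped TensorProduct
open NumberField CategoryTheory Module

namespace Summit.HodgeConjecture.CorCM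

namespace CMBettiModel

open Literature.AlgebraicGeometry.Motives (CMType HodgeStructure AbelianVariety bettiCohomology IsSmoothProjective
  SchemeOver)
open Literature.AlgebraicGeometry.HodgeTheory (complexBetti IsOfHodgeType exists_isReal_hodgeModel
  hodgePQ_independent_of_hodgeModel)
open Literature.AlgebraicGeometry.HodgeTheory.BettiUniverse (cmAction cmEndAction cmEndAction_ι IsInducedOnIntegers)
open Literature.AlgebraicGeometry.ComplexMultiplication (IsCMTypeRealisation)

variable {K : Type} [Field K] [NumberField K]

/-! ### `H¹(A(ℂ); ℚ)` is a `K`-line -/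

section Orbit

variable {A : SchemeOver ℂ} (θ : K →+* Module.End ℂ (complexBetti A 1)) (hθ : IsInducedOnIntegers θ)

/-- The orbit map `k ↦ k ⋅ v` of a non-zero vector under the action of a FIELD is injective
(`k ⋅ v = 0`, `k ≠ 0` ⇒ `v = k⁻¹ ⋅ k ⋅ v = 0`). -/
theorem orbit_injective {v : bettiCohomology A 1} (hv : v ≠ 0) :
    Function.Injective fun k : K => cmAction θ hθ k v := by
  intro k₁ k₂ h12
  by_contra hne
  have hk : k₁ - k₂ ≠ 0 := sub_ne_zero.2 hne
  have hsub : cmAction θ hθ (k₁ - k₂) v = 0 := by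
    rw [map_sub, LinearMap.sub_apply]
    exact sub_eq_zero.2 h12
  apply hv
  calc v = cmAction θ hθ ((k₁ - k₂)⁻¹ * (k₁ - k₂)) v := by
          rw [inv_mul_cancel₀ hk, map_one, Module.End.one_apply]
    _ = cmAction θ hθ (k₁ - k₂)⁻¹ (cmAction θ hθ (k₁ - k₂) v) := by
          rw [map_mul, Module.End.mul_apply]
    _ = 0 := by rw [hsub, map_zero]

/-- **`H¹(A(ℂ); ℚ)` is a `K`-line**: if `dim_ℚ H¹(A(ℂ); ℚ) = [K:ℚ]` there is a `K`-EQUIVARIANT `ℚ`-linear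
isomorphism `e : K ≃ H¹(A(ℂ); ℚ)`, `e (k x) = k ⋅ e x` — the orbit map of any non-zero vector
(Shimura 1998 §3.2: the rational representation of `K` on `H¹(A, ℚ)` is the regular one). -/
theorem exists_equivariant_equiv {g : ℕ} (hA : IsSmoothProjective g A)
    (hrk : Module.finrank ℚ (bettiCohomology A 1) = Module.finrank ℚ K) :
    ∃ e : K ≃ₗ[ℚ] bettiCohomology A 1, ∀ k x, e (k * x) = cmAction θ hθ k (e x) := by
  haveI : Module.Finite ℚ (bettiCohomology A 1) :=
    Literature.AlgebraicGeometry.HodgeTheory.BettiUniverse.finite hA 1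
  have hpos : 0 < Module.finrank ℚ (bettiCohomology A 1) := by
    rw [hrk]; exact Module.finrank_pos
  obtain ⟨v, hv⟩ := Module.finrank_pos_iff_exists_ne_zero.1 hpos
  let f : K →ₗ[ℚ] bettiCohomology A 1 := (LinearMap.applyₗ v).comp (cmAction θ hθ).toLinearMap
  have hf : ∀ k, f k = cmAction θ hθ k v := fun k => rfl
  have hinj : Function.Injective f := orbit_injective θ hθ hv
  refine ⟨f.linearEquivOfInjective hinj hrk.symm, fun k x => ?_⟩
  rw [LinearMap.linearEquivOfInjective_apply, LinearMap.linearEquivOfInjective_apply, hf, hf, map_mul,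
    Module.End.mul_apply]

end Orbit

/-! ### Rigidity: every equivariant isomorphism is an isomorphism of Hodge structures -/

section Rigidity

variable {Φ : CMType K} {A : AbelianVariety ℂ} {ι : 𝓞 K →+* End A}
  {θ : K →+* Module.End ℂ (complexBetti A.X 1)}

/-- The complexification of a `K`-equivariant map is `K`-equivariant:
`e_ℂ ((k ⋅)_ℂ t) = (k ⋅)_ℂ (e_ℂ t)`. -/
theorem baseChange_equivariant (hθ : IsInducedOnIntegers θ) (e : K ≃ₗ[ℚ] bettiCohomology A.X 1)
    (he : ∀ k x, e (k * x) = cmAction θ hθ k (e x)) (k : K) (t : ℂ ⊗[ℚ] K) :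
    e.toLinearMap.baseChange ℂ ((Algebra.lmul ℚ K k).baseChange ℂ t) =
      (cmAction θ hθ k : Module.End ℚ (bettiCohomology A.X 1)).baseChange ℂ (e.toLinearMap.baseChange ℂ t) := by
  have hlin : e.toLinearMap ∘ₗ (Algebra.lmul ℚ K k : Module.End ℚ K) =
      (cmAction θ hθ k : Module.End ℚ (bettiCohomology A.X 1)) ∘ₗ e.toLinearMap :=
    LinearMap.ext fun x => by simpa using he k x
  have h := congrArg (fun f : K →ₗ[ℚ] bettiCohomology A.X 1 => f.baseChange ℂ t) hlin
  simpa only [LinearMap.baseChange_comp, LinearMap.comp_apply] using h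

/-- **`e_ℂ` carries the eigen-line `(ℂ ⊗ K)_σ` ONTO the `σ`-eigenspace `H¹(A)_σ`** of the complexified rational
CM action, for every `K`-equivariant `ℚ`-isomorphism `e : K ≃ H¹(A(ℂ); ℚ)` (into: equivariance; onto: both are
lines — `CMTypeHodge.finrank_eigenLine`, `BettiUniverse.finrank_eigenLine_eq_one`).
[cite: Deligne1982HodgeCycles, §4] [cite: Shimura1998, §3.2, pp. 20–22] -/
theorem map_eigenLine_eq (h : IsCMTypeRealisation Φ A ι θ) (hHD : exists_isReal_hodgeModel)
    (hI : hodgePQ_independent_of_hodgeModel) (e : K ≃ₗ[ℚ] bettiCohomology A.X 1)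
    (he : ∀ k x, e (k * x) = cmAction θ h.isInducedOnIntegers k (e x)) (σ : K →+* ℂ) :
    (CMTypeHodge.eigenLine K σ).map (e.toLinearMap.baseChange ℂ) =
      ⨅ k : K, Module.End.eigenspace
        (((cmEndAction θ h.isInducedOnIntegers hHD hI h.1).ι k).baseChange ℂ) (σ k) := by
  haveI : Module.Finite ℚ (bettiCohomology A.X 1) :=
    Literature.AlgebraicGeometry.HodgeTheory.BettiUniverse.finite h.1 1
  -- into, by equivariance
  have hle : (CMTypeHodge.eigenLine K σ).map (e.toLinearMap.baseChange ℂ) ≤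
      ⨅ k : K, Module.End.eigenspace
        (((cmEndAction θ h.isInducedOnIntegers hHD hI h.1).ι k).baseChange ℂ) (σ k) := by
    rintro _ ⟨t, ht, rfl⟩
    rw [Submodule.mem_iInf]
    intro k
    rw [Module.End.mem_eigenspace_iff, cmEndAction_ι,
      ← baseChange_equivariant h.isInducedOnIntegers e he k t]
    have hk := (Submodule.mem_iInf _).1 ht k
    rw [Module.End.mem_eigenspace_iff] at hk
    rw [hk, map_smul]
  -- onto, by dimension
  refine Submodule.eq_of_le_of_finrank_eq hle ?_
  rw [Literature.AlgebraicGeometry.HodgeTheory.BettiUniverse.finrank_eigenLine_eq_one θ h.isInducedOnIntegers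
    hHD hI h.1 σ (h.2.2.2 σ).1]
  have hm : (CMTypeHodge.eigenLine K σ).map (e.toLinearMap.baseChange ℂ) =
      (CMTypeHodge.eigenLine K σ).map (e.baseChange ℚ ℂ K (bettiCohomology A.X 1)).toLinearMap := rfl
  rw [hm, LinearEquiv.finrank_map_eq, CMTypeHodge.finrank_eigenLine]

/-- **`F¹ H¹(A) = ⊕_{σ ∈ Φ} H¹(A)_σ`**: the last step of the Hodge filtration of `H¹(A(ℂ); ℚ)` (= `H^{1,0}`,
`F⁰ = ` everything) is the sum over the CM type of the `σ`-eigenspaces of the rational CM action — the CM-type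
clauses `σ ∈ Φ ⇒ H^{1,0}_σ = H¹_σ`, `σ ∉ Φ ⇒ H^{1,0}_σ = 0` (`BettiUniverse.eigenPiece_one_zero_eq_eigenLine`,
`eigenPiece_one_zero_eq_bot`) summed by `V^{1,0} = ⊕_σ V^{1,0}_σ` (`EndAction.iSup_eigenPiece_holds`).
[cite: Shimura1998, §5.2, pp. 36–37] [cite: Deligne1982HodgeCycles, §5] -/
theorem F_one_eq_iSup (h : IsCMTypeRealisation Φ A ι θ) (hHD : exists_isReal_hodgeModel)
    (hI : hodgePQ_independent_of_hodgeModel) :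
    (Literature.AlgebraicGeometry.HodgeTheory.BettiUniverse.hodge hHD h.1 1).F 1 =
      ⨆ σ ∈ CMTypeHodge.holIndex K Φ, ⨅ k : K, Module.End.eigenspace
        (((cmEndAction θ h.isInducedOnIntegers hHD hI h.1).ι k).baseChange ℂ) (σ k) := by
  set H := Literature.AlgebraicGeometry.HodgeTheory.BettiUniverse.hodge hHD h.1 1 with hH
  have hF0 : H.F 0 = ⊤ := Literature.AlgebraicGeometry.HodgeTheory.HodgeModel.ratF_of_nonpos _ h.1 1 le_rfl
  have hF1 : H.F 1 = H.piece 1 0 := by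
    rw [HodgeStructure.piece_of_add_eq H (by norm_num), hF0, HodgeStructure.complexConj_top, inf_top_eq]
  rw [hF1, ← HodgeStructure.EndAction.iSup_eigenPiece_holds (cmEndAction θ h.isInducedOnIntegers hHD hI h.1) 1 0]
  refine le_antisymm (iSup_le fun σ => ?_) (iSup₂_le fun σ hσ => ?_)
  · by_cases hσ : σ ∈ Φ.1
    · rw [Literature.AlgebraicGeometry.HodgeTheory.BettiUniverse.eigenPiece_one_zero_eq_eigenLine θ
        h.isInducedOnIntegers hHD hI h.1 σ ((h.2.2.2 σ).2.1 hσ)]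
      exact le_iSup₂_of_le σ ((CMTypeHodge.mem_holIndex K Φ).2 hσ) le_rfl
    · rw [Literature.AlgebraicGeometry.HodgeTheory.BettiUniverse.eigenPiece_one_zero_eq_bot θ
        h.isInducedOnIntegers hHD hI h.1 σ ((h.2.2.2 σ).2.2 hσ)]
      exact bot_le
  · rw [← Literature.AlgebraicGeometry.HodgeTheory.BettiUniverse.eigenPiece_one_zero_eq_eigenLine θ
      h.isInducedOnIntegers hHD hI h.1 σ ((h.2.2.2 σ).2.1 ((CMTypeHodge.mem_holIndex K Φ).1 hσ))]
    exact le_iSup (fun τ => (cmEndAction θ h.isInducedOnIntegers hHD hI h.1).eigenPiece τ 1 0) σ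

/-- **`e_ℂ (H^{1,0} of the CM type) = F¹ H¹(A)`** for every `K`-equivariant `ℚ`-isomorphism `e`.
[cite: Deligne1982HodgeCycles, Example 3.7] -/
theorem map_holPart_eq (h : IsCMTypeRealisation Φ A ι θ) (hHD : exists_isReal_hodgeModel)
    (hI : hodgePQ_independent_of_hodgeModel) (e : K ≃ₗ[ℚ] bettiCohomology A.X 1)
    (he : ∀ k x, e (k * x) = cmAction θ h.isInducedOnIntegers k (e x)) :
    (CMTypeHodge.holPart K Φ).map (e.toLinearMap.baseChange ℂ) =
      (Literature.AlgebraicGeometry.HodgeTheory.BettiUniverse.hodge hHD h.1 1).F 1 := by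
  rw [F_one_eq_iSup h hHD hI, CMTypeHodge.holPart, Finset.sup_eq_iSup]
  simp only [Submodule.map_iSup, map_eigenLine_eq h hHD hI e he]

/-- **Rigidity: every `K`-equivariant `ℚ`-linear isomorphism `K ≃ H¹(A(ℂ); ℚ)` is an isomorphism of Hodge
structures** from the CM-type structure `CMTypeHodge.hodge K Φ` to `BettiUniverse.hodge hHD hA 1` — in the tree's
idiom, `CMTypeHodge.hodge K Φ = (BettiUniverse.hodge hHD hA 1).comapEquiv e`.  (`F^{≤ 0}`: everything on both
sides; `F¹`: `map_holPart_eq`; `F^{≥ 2} = 0` on both sides.)  Deligne: an `E`-Hodge structure of weight one with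
`dim_E V = 1` is determined by its CM type. [cite: Deligne1982HodgeCycles, Example 3.7 and §5]
[cite: Shimura1998, §5.2, pp. 36–37] -/
theorem hodge_eq_comapEquiv (h : IsCMTypeRealisation Φ A ι θ) (hHD : exists_isReal_hodgeModel)
    (hI : hodgePQ_independent_of_hodgeModel) (e : K ≃ₗ[ℚ] bettiCohomology A.X 1)
    (he : ∀ k x, e (k * x) = cmAction θ h.isInducedOnIntegers k (e x)) :
    CMTypeHodge.hodge K Φ =
      (Literature.AlgebraicGeometry.HodgeTheory.BettiUniverse.hodge hHD h.1 1).comapEquiv e := by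
  have hinj : Function.Injective (e.toLinearMap.baseChange ℂ) := HodgeStructure.baseChange_injective_of_equiv e
  apply HodgeStructure.ext
  funext p
  rw [HodgeStructure.comapEquiv_F]
  show HodgeStructure.twoStepFiltration (CMTypeHodge.holPart K Φ) 1 p = _
  by_cases hp : p ≤ 0
  · rw [HodgeStructure.twoStepFiltration_of_le_zero _ hp,
      Literature.AlgebraicGeometry.HodgeTheory.BettiUniverse.hodge_F,
      Literature.AlgebraicGeometry.HodgeTheory.HodgeModel.ratF_of_nonpos _ h.1 1 hp, Submodule.comap_top]
  by_cases hp1 : 1 < p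
  · rw [HodgeStructure.twoStepFiltration_of_lt _ (by omega) hp1,
      Literature.AlgebraicGeometry.HodgeTheory.BettiUniverse.hodge_F,
      Literature.AlgebraicGeometry.HodgeTheory.HodgeModel.ratF_eq_bot _ h.1 1 (by exact_mod_cast hp1),
      Submodule.comap_bot]
    exact (LinearMap.ker_eq_bot.2 hinj).symm
  obtain rfl : p = 1 := by omega
  rw [HodgeStructure.twoStepFiltration_of_pos_of_le _ one_pos le_rfl, ← map_holPart_eq h hHD hI e he,
    Submodule.comap_map_eq_of_injective hinj]

/-- **The CM-type Hodge structure is the Betti `H¹` of every realisation**: for `IsCMTypeRealisation Φ A ι θ`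
there is a `K`-equivariant `ℚ`-linear isomorphism `e : K ≃ H¹(A(ℂ); ℚ)` which is an isomorphism of Hodge
structures `CMTypeHodge.hodge K Φ ≅ BettiUniverse.hodge hHD hA 1`. [cite: Deligne1982HodgeCycles, Example 3.7 and §5]
[cite: Shimura1998, §6.2 Theorem 3] -/
theorem exists_hodge_eq_comapEquiv (h : IsCMTypeRealisation Φ A ι θ) (hHD : exists_isReal_hodgeModel)
    (hI : hodgePQ_independent_of_hodgeModel) :
    ∃ e : K ≃ₗ[ℚ] bettiCohomology A.X 1,
      (∀ k x, e (k * x) = cmAction θ h.isInducedOnIntegers k (e x)) ∧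
      CMTypeHodge.hodge K Φ =
        (Literature.AlgebraicGeometry.HodgeTheory.BettiUniverse.hodge hHD h.1 1).comapEquiv e := by
  obtain ⟨e, he⟩ := exists_equivariant_equiv θ h.isInducedOnIntegers h.1
    (Literature.AlgebraicGeometry.HodgeTheory.BettiUniverse.finrank_bettiCohomology_one_eq h.1 h.2.1)
  exact ⟨e, he, hodge_eq_comapEquiv h hHD hI e he⟩

end Rigidity

/-! ### The Betti `H¹` of a realisation is of CM type `Φ` in the tree's abstract vocabulary -/

section BettiCMType

variable {Φ : CMType K} {A : AbelianVariety ℂ} {ι : 𝓞 K →+* End A}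
  {θ : K →+* Module.End ℂ (complexBetti A.X 1)}

/-- **`n_σ = 1` for `σ ∈ Φ`**: the multiplicity (`dim_ℂ H^{1,0}_σ`, `EndAction.multiplicity`) of an embedding of
the CM type in `H^{1,0}(A)` is one (`H^{1,0}_σ = H¹_σ`, a line). [cite: Shimura1998, §5.2, pp. 36–37]
[cite: Deligne1982HodgeCycles, §5] -/
theorem multiplicity_eq_one_of_mem (h : IsCMTypeRealisation Φ A ι θ) (hHD : exists_isReal_hodgeModel)
    (hI : hodgePQ_independent_of_hodgeModel) {σ : K →+* ℂ} (hσ : σ ∈ Φ.1) :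
    (cmEndAction θ h.isInducedOnIntegers hHD hI h.1).multiplicity σ = 1 := by
  rw [HodgeStructure.EndAction.multiplicity,
    Literature.AlgebraicGeometry.HodgeTheory.BettiUniverse.eigenPiece_one_zero_eq_eigenLine θ
      h.isInducedOnIntegers hHD hI h.1 σ ((h.2.2.2 σ).2.1 hσ)]
  exact Literature.AlgebraicGeometry.HodgeTheory.BettiUniverse.finrank_eigenLine_eq_one θ
    h.isInducedOnIntegers hHD hI h.1 σ (h.2.2.2 σ).1

/-- **`n_σ = 0` for `σ ∉ Φ`**: an embedding outside the CM type does not occur in `H^{1,0}(A)`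
(`H^{1,0}_σ = 0`). [cite: Shimura1998, §5.2, pp. 36–37] [cite: Deligne1982HodgeCycles, §5] -/
theorem multiplicity_eq_zero_of_not_mem (h : IsCMTypeRealisation Φ A ι θ) (hHD : exists_isReal_hodgeModel)
    (hI : hodgePQ_independent_of_hodgeModel) {σ : K →+* ℂ} (hσ : σ ∉ Φ.1) :
    (cmEndAction θ h.isInducedOnIntegers hHD hI h.1).multiplicity σ = 0 := by
  rw [HodgeStructure.EndAction.multiplicity,
    Literature.AlgebraicGeometry.HodgeTheory.BettiUniverse.eigenPiece_one_zero_eq_bot θ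
      h.isInducedOnIntegers hHD hI h.1 σ ((h.2.2.2 σ).2.2 hσ), finrank_bot]

/-- **The CM type of `H¹(A(ℂ); ℚ)` read through `EndAction.cmType` (`= {σ | n_σ = 1}`) is `Φ`** — the two
encodings of «`(A, ι)` is of type `(K; Φ)`» in the tree (the eigen-line clauses of `IsCMTypeRealisation` and the
abstract `EndAction.cmType` of `Motives/WeilTypeCM`) agree. [cite: Deligne1982HodgeCycles, §5]
[cite: Shimura1998, §5.2, pp. 36–37] -/
theorem cmType_eq (h : IsCMTypeRealisation Φ A ι θ) (hHD : exists_isReal_hodgeModel)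
    (hI : hodgePQ_independent_of_hodgeModel) :
    (cmEndAction θ h.isInducedOnIntegers hHD hI h.1).cmType = Φ.1 := by
  ext σ
  rw [HodgeStructure.EndAction.mem_cmType_iff]
  by_cases hσ : σ ∈ Φ.1
  · exact ⟨fun _ => hσ, fun _ => multiplicity_eq_one_of_mem h hHD hI hσ⟩
  · rw [multiplicity_eq_zero_of_not_mem h hHD hI hσ]
    exact ⟨fun h0 => absurd h0 zero_ne_one, fun h' => absurd h' hσ⟩

/-- **`H¹(A(ℂ); ℚ)` is a `K`-line** for the `K`-module structure of the rational CM action (`EndAction.module`):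
`dim_K H¹(A(ℂ); ℚ) = 1` (any `K`-equivariant `ℚ`-isomorphism `K ≃ H¹(A(ℂ); ℚ)` is `K`-linear).
[cite: Shimura1998, §3.2, pp. 20–22] -/
theorem finrank_eq_one (h : IsCMTypeRealisation Φ A ι θ) (hHD : exists_isReal_hodgeModel)
    (hI : hodgePQ_independent_of_hodgeModel) :
    letI := (cmEndAction θ h.isInducedOnIntegers hHD hI h.1).module
    Module.finrank K (bettiCohomology A.X 1) = 1 := by
  letI := (cmEndAction θ h.isInducedOnIntegers hHD hI h.1).module
  obtain ⟨e, he⟩ := exists_equivariant_equiv θ h.isInducedOnIntegers h.1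
    (Literature.AlgebraicGeometry.HodgeTheory.BettiUniverse.finrank_bettiCohomology_one_eq h.1 h.2.1)
  let e' : K ≃ₗ[K] bettiCohomology A.X 1 :=
    e.toAddEquiv.toLinearEquiv fun k x => by
      show e (k * x) = cmAction θ h.isInducedOnIntegers k (e x)
      exact he k x
  rw [← e'.finrank_eq, Module.finrank_self]

/-- **The rational CM action of a realisation of `(K; Φ)`, `K` a CM field, `IsCM`** in the sense of
`Motives.HodgeStructure.EndAction.IsCM` (`H¹` effective — `BettiUniverse.hodge_isEffective` —, `K` CM, and
`dim_K H¹(A(ℂ); ℚ) = 1`): the realisation's `H¹` is an abstract `K`-Hodge structure of CM type, with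
`cmType = Φ` (`cmType_eq`). [cite: Deligne1982HodgeCycles, §5] [cite: Shimura1998, §6.2 Theorem 3] -/
theorem isCM [IsCMField K] (h : IsCMTypeRealisation Φ A ι θ) (hHD : exists_isReal_hodgeModel)
    (hI : hodgePQ_independent_of_hodgeModel) :
    (cmEndAction θ h.isInducedOnIntegers hHD hI h.1).IsCM :=
  ⟨Literature.AlgebraicGeometry.HodgeTheory.BettiUniverse.hodge_isEffective hHD h.1 1, ‹IsCMField K›,
    finrank_eq_one h hHD hI⟩

end BettiCMType

end CMBettiModel

end Summit.HodgeConjecture.CorCM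

end
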